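import Summits.MatrixMultiplication.MatrixMultiplication.Theorems.GraphEquationsFibreJet

/-!
# GraphEquations — generator cells and the adjoining surgery (THEOREM ED (b), part 3/4)

Decomp-mm node «GraphEquations» (lens 5); attacked crux `MultiplicityReduction` (route
GraphEquations, item stmt-MatrixMultiplication-27806), registered line
`Cruxes/MultiplicityReduction/Lines/birth.lean` («exponent ladder»).  Part of THEOREM ED
(`Theorems/GraphEquationsExponentDescent.lean` proves its middle stub `stub_exponentDescent` by
statement); paper lens-5 g94, Lean text g95–g101, first elaborated g122.

* S3  the generator cell `genCell q` and system `genSystem qs` (definitions in `…Defs`): gate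
  values, cost `2n`, fan-in two, soundness and completeness of the tests; and
  `EqSystem.exists_adjoin_reducedAt`: adjoining the generators of `corank`-many separating kernel
  coordinates to a correct system gives a correct system REDUCED at `x`, at cost `+ 2n · corank`,
  with the old test ideal contained in the new one.
-/

set_option linter.dupNamespace false

namespace Summit.MatrixMultiplication.MatrixMultiplication.Theorems.GraphEquations

open MvPolynomial
-- `Basis` below is `Module.Basis` (tree precedent `open Matrix Module`,
-- GraphEquationsCorankUnmasking l.49).
open Module
open Literature.Computability.AlgebraicComplexity
open Literature.Computability.AlgebraicComplexity.ArithCircuit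
open Literature.AlgebraicGeometry.Hironaka2017.EdgeAlgebra (isHomogeneous_aeval_linear
  homogeneousComponent_aeval_linear)
open Literature.AlgebraicGeometry.Resolution (homogeneousComponent_eq_zero_of_mem_pow_idealOfVars
  mem_pow_idealOfVars_of_isHomogeneous sub_sum_homogeneousComponent_mem_pow_idealOfVars)

variable {n : ℕ}

/-! ## S3 (b2): the generator cell — `f_q = c_q − Σ_k a_{q₁k} b_{kq₂}` in `2n` fan-in-two gates -/

/-- The product gate evaluates to `a_{q₁k} b_{kq₂}` (or `1` past the range). -/
theorem genProd_eval (q : Fin n × Fin n) (k : ℕ) (vals : List (MvPolynomial (GraphVars n) ℂ)) :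
    (genProd q k).eval vals = prodVal q k := by
  unfold genProd prodVal
  split_ifs with h <;> simp [Gate.eval, Operand.eval]

/-- Product gates have fan-in at most two. -/
theorem genProd_fanIn_le (q : Fin n × Fin n) (k : ℕ) : (genProd q k).fanIn ≤ 2 := by
  unfold genProd
  split_ifs <;> simp [Gate.fanIn, Gate.args]

/-- Sum gates have fan-in two. -/
theorem genSum_fanIn (q : Fin n × Fin n) (k : ℕ) : (genSum q k).fanIn = 2 := by
  cases k with
  | zero => exact testGate_fanIn q 0
  | succ k => simp [genSum, Gate.fanIn, Gate.args]

/-- `k` rounds of the generator cell use `2k` gates. -/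
@[simp] theorem genCellGates_length (q : Fin n × Fin n) (k : ℕ) :
    (genCellGates q k).length = 2 * k := by
  induction k with
  | zero => rfl
  | succ k ih => simp only [genCellGates, List.length_append, List.length_singleton, ih]; omega

/-- Values of the cell: round `k+1` appends `prodVal q k` and `partialGen q k`. -/
theorem gateValues_genCellGates_succ (q : Fin n × Fin n) (k : ℕ) :
    gateValues (genCellGates q (k + 1)) =
      gateValues (genCellGates q k) ++ [prodVal q k] ++ [partialGen q k] := by
  induction k with
  | zero =>
    -- `σ₀ = testGate q 0` against `[p₀]`: `c_q − p₀` (`testGate_eval`, Generators l.92)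
    -- `gateValues [] = []` is `rfl`; `Finset.sum_range_one`.
    simp [genCellGates, genProd_eval, genSum, testGate_eval, partialGen, gateValues]
  | succ k ih =>
    -- S3 (b2).
    -- `σ_{k+1}` reads index `2k+1` (= `partialGen q k`, the last entry of round `k+1`, by `ih`)
    -- and index `2k+2` (= the just appended `prodVal q (k+1)`), in the list
    -- `L := gateValues (genCellGates q k) ++ [prodVal q k] ++ [partialGen q k] ++ [prodVal q (k+1)]`
    -- of length `2k+3`.  Look-ups by Lean core `List.getD_eq_getElem?_getD : l.getD i a =
    -- (l[i]?).getD a` (Init/Data/List/Lemmas.lean l.344), `List.getElem?_append_left :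
    -- i < l₁.length → (l₁ ++ l₂)[i]? = l₁[i]?` (l.1626), `List.getElem?_concat_length :
    -- (l ++ [a])[l.length]? = some a` (l.322), `Option.getD_some`.
    rw [genCellGates, gateValues_append_singleton, gateValues_append_singleton, genProd_eval, ih]
    have hlen1 : (gateValues (genCellGates q k) ++ [prodVal q k]).length = 2 * k + 1 := by
      simp only [List.length_append, List.length_singleton, gateValues_length, genCellGates_length]
    have hlen2 : (gateValues (genCellGates q k) ++ [prodVal q k] ++ [partialGen q k]).length =
        2 * k + 2 := by
      simp only [List.length_append, List.length_singleton, gateValues_length, genCellGates_length]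
    have hlt : 2 * k + 1 <
        (gateValues (genCellGates q k) ++ [prodVal q k] ++ [partialGen q k]).length := by
      rw [hlen2]; omega
    -- `rw [← hlen1]` / `rw [← hlen2]` touch only the index (no other `2 * k + 1`, `2 * k + 2`
    -- occurs in these goals).
    have h1 : (gateValues (genCellGates q k) ++ [prodVal q k] ++ [partialGen q k] ++
        [prodVal q (k + 1)]).getD (2 * k + 1) 0 = partialGen q k := by
      rw [List.getD_eq_getElem?_getD, List.getElem?_append_left hlt, ← hlen1,
        List.getElem?_concat_length, Option.getD_some]
    have h2 : (gateValues (genCellGates q k) ++ [prodVal q k] ++ [partialGen q k] ++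
        [prodVal q (k + 1)]).getD (2 * k + 2) 0 = prodVal q (k + 1) := by
      rw [List.getD_eq_getElem?_getD, ← hlen2, List.getElem?_concat_length, Option.getD_some]
    -- the new sum gate `σ_{k+1} = 1 • L[2k+1] + (-1) • L[2k+2]` evaluates to `partialGen q (k+1)`
    -- simp normal form `1 • _ + -1 • _` of `Gate.eval`/`Operand.eval` (ArithCircuit l.105–113)
    -- on the literal operand list of `genSum q (k+1)`.
    have hval : (genSum q (k + 1)).eval (gateValues (genCellGates q k) ++ [prodVal q k] ++
        [partialGen q k] ++ [prodVal q (k + 1)]) = partialGen q (k + 1) := by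
      simp only [genSum, Gate.eval, List.map_cons, List.map_nil, List.sum_cons, List.sum_nil,
        add_zero, Operand.eval]
      rw [h1, h2, one_smul, neg_smul, one_smul]
      unfold partialGen
      rw [Finset.sum_range_succ _ (k + 1)]
      ring
    rw [hval]

namespace EqSystem

/-- The generator cell costs `2n` gates. -/
theorem genCell_cost (q : Fin n × Fin n) : (genCell q).cost = 2 * n := by
  simp [genCell, cost, ArithCircuit.size]

/-- The generator cell tests its last gate. -/
theorem genCell_tests (q : Fin n × Fin n) : (genCell q).tests = [2 * n - 1] := rfl

/-- The generator cell is fan-in-two. -/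
theorem genCell_isFanInTwo (q : Fin n × Fin n) : (genCell q).circuit.IsFanInTwo := by
  suffices h : ∀ k, ∀ g ∈ genCellGates q k, g.fanIn ≤ 2 from fun g hg => h n g hg
  intro k
  induction k with
  | zero => intro g hg; simp [genCellGates] at hg
  | succ k ih =>
    intro g hg
    simp only [genCellGates, List.mem_append, List.mem_singleton] at hg
    rcases hg with (hg | rfl) | rfl
    · exact ih g hg
    · exact genProd_fanIn_le q k
    · exact (genSum_fanIn q k).le

/-- The test of the cell is the generator: `σ_{n−1} = c_q − Σ_{k<n} a_{q₁k} b_{kq₂} = f_q`. -/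
theorem genCell_testPoly (hn : 1 ≤ n) (q : Fin n × Fin n) :
    (genCell q).testPoly (2 * n - 1) = generator n q := by
  obtain ⟨m, hm⟩ : ∃ m, n = m + 1 := ⟨n - 1, by omega⟩
  subst hm
  have hidx : 2 * (m + 1) - 1 = (gateValues (genCellGates q m) ++ [prodVal q m]).length := by
    simp [gateValues_length]; omega
  unfold testPoly
  simp only [genCell]
  rw [gateValues_genCellGates_succ, hidx, List.getD_eq_getElem?_getD,
    List.getElem?_append_right le_rfl, Nat.sub_self]
  -- `[partialGen q m][0]? = some _`, `Option.getD`.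
  simp only [List.getElem?_cons_zero, Option.getD_some]
  -- `partialGen q m = generator (m+1) q`
  unfold partialGen generator
  congr 1
  rw [← Fin.sum_univ_eq_sum_range (fun i => prodVal q i) (m + 1)]
  refine Finset.sum_congr rfl fun i _ => ?_
  simp [prodVal, i.isLt]

/-! ## S3 (b2–b3): the generator system of a list of coordinates -/

/-- Unfolding `genSystem` on a cons. -/
theorem genSystem_cons (q : Fin n × Fin n) (qs : List (Fin n × Fin n)) :
    genSystem (q :: qs) = (genCell q).juxt (genSystem qs) := rfl

/-- The generator system of `qs` costs `2n · |qs|`. -/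
theorem genSystem_cost : ∀ qs : List (Fin n × Fin n), (genSystem qs).cost = 2 * n * qs.length
  | [] => by simp [genSystem, nilSystem, cost, ArithCircuit.size]
  | q :: qs => by
    rw [genSystem_cons, juxt_cost, genCell_cost, genSystem_cost qs, List.length_cons]
    ring

/-- Generator systems are fan-in-two. -/
theorem genSystem_isFanInTwo : ∀ qs : List (Fin n × Fin n), (genSystem qs).circuit.IsFanInTwo
  | [] => by intro g hg; simp [genSystem, nilSystem] at hg
  | q :: qs => by
    rw [genSystem_cons]
    exact juxt_isFanInTwo (genCell_isFanInTwo q) (genSystem_isFanInTwo qs)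

/-- Soundness: every test of `genSystem qs` is a generator `f_q`, `q ∈ qs` (uses L4). -/
theorem genSystem_sound (hn : 1 ≤ n) : ∀ qs : List (Fin n × Fin n), ∀ j ∈ (genSystem qs).tests,
    ∃ q ∈ qs, (genSystem qs).testPoly j = generator n q
  | [], j, hj => by simp [genSystem, nilSystem] at hj
  | q :: qs, j, hj => by
    rw [genSystem_cons] at hj ⊢
    rcases mem_juxt_tests.mp hj with hj | ⟨i, hi, rfl⟩
    · have hj' : j = 2 * n - 1 := by simpa [genCell_tests] using hj
      subst hj'
      refine ⟨q, List.mem_cons_self .., ?_⟩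
      rw [juxt_testPoly_left _ _ (by rw [genCell_cost]; omega), genCell_testPoly hn]
    · obtain ⟨q', hq', h⟩ := genSystem_sound hn qs i hi
      exact ⟨q', List.mem_cons_of_mem _ hq', by rw [juxt_testPoly_right, h]⟩

/-- Completeness: every `f_q`, `q ∈ qs`, is a test of `genSystem qs`. -/
theorem genSystem_complete (hn : 1 ≤ n) : ∀ qs : List (Fin n × Fin n), ∀ q ∈ qs,
    ∃ j ∈ (genSystem qs).tests, (genSystem qs).testPoly j = generator n q
  | [], q, hq => by simp at hq
  | q' :: qs, q, hq => by
    rw [genSystem_cons]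
    rcases List.mem_cons.mp hq with rfl | hq
    · refine ⟨2 * n - 1, mem_juxt_tests_left (by simp [genCell_tests]), ?_⟩
      rw [juxt_testPoly_left _ _ (by rw [genCell_cost]; omega), genCell_testPoly hn]
    · obtain ⟨j, hj, h⟩ := genSystem_complete hn qs q hq
      exact ⟨j + (genCell q').cost, mem_juxt_tests_right hj, by rw [juxt_testPoly_right, h]⟩

/-! ## S3: adjoining the kernel coordinates (THEOREM ED (b), surgery half) -/

/-- **S3.**  For a correct `E` and `x ∈ W_n` there is a correct `E′ ⊇ E` (as test ideals), reduced
at `x`, of cost `≤ cost E + 2n · corank_x(E)`: `E′ = E.trim ⊔ (cells of q ∈ qs)` for `≤ corank`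
coordinates `qs` separating `K = ker J_C(E)(x)` from `0` (`exists_coords_separating`,
CorankUnmasking l.57).  A kernel vector of `J_C(E′)(x)` lies in `K` (old rows; L6) and has
`δ_q = 0` for `q ∈ qs` (new rows `∂f_q/∂c_p = [p = q]`, E-a), hence vanishes. -/
theorem exists_adjoin_reducedAt {E : EqSystem n} (hE : E.Correct) (hn : 1 ≤ n)
    {x : GraphVars n → ℂ} (_hx : x ∈ mmGraph n) :
    ∃ E' : EqSystem n, E'.Correct ∧ E'.ReducedAt x ∧ E'.cost ≤ E.cost + 2 * n * E.corank x ∧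
      Ideal.span {p | ∃ j ∈ E.tests, p = E.testPoly j} ≤
        Ideal.span {p | ∃ j ∈ E'.tests, p = E'.testPoly j} := by
  classical
  obtain ⟨qs, hlen, hsep⟩ := exists_coords_separating (LinearMap.ker (E.jacobianC x).mulVecLin)
  have hEt : E.trim.Correct := trim_correct hE
  refine ⟨E.trim.juxt (genSystem qs), ?_, ?_, ?_, ?_⟩
  · -- correct (`Correct.of_contains`, CorrectedDeflation l.258; F4: trim first)
    refine hEt.of_contains (juxt_isFanInTwo hEt.1 (genSystem_isFanInTwo qs)) (fun j hj => ?_)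
      (fun j' hj' => ?_)
    · exact ⟨j, mem_juxt_tests_left hj,
        juxt_testPoly_left _ _ (by simpa using (mem_trim_tests.mp hj).2)⟩
    · rcases mem_juxt_tests.mp hj' with h | ⟨i, hi, rfl⟩
      · rw [juxt_testPoly_left _ _ (by simpa using (mem_trim_tests.mp h).2)]
        exact hEt.testPoly_mem_graphIdeal' h
      · rw [juxt_testPoly_right]
        obtain ⟨q, -, hq⟩ := genSystem_sound hn qs i hi
        rw [hq]
        exact generator_mem_graphIdeal q
  · -- reduced at `x`: trivial kernel
    apply reducedAt_of_ker_eq_bot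
    rw [Submodule.eq_bot_iff]
    intro δ hδ
    rw [LinearMap.mem_ker, Matrix.mulVecLin_apply, jacobianC_mulVec_eq_zero_iff_tests] at hδ
    have hK : δ ∈ LinearMap.ker (E.jacobianC x).mulVecLin := by
      rw [← ker_jacobianC_trim E x, LinearMap.mem_ker, Matrix.mulVecLin_apply,
        jacobianC_mulVec_eq_zero_iff_tests]
      intro j hj
      have h := hδ j (mem_juxt_tests_left hj)
      rwa [juxt_testPoly_left _ _ (by simpa using (mem_trim_tests.mp hj).2)] at h
    have hq : ∀ q ∈ qs, δ q = 0 := by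
      intro q hq
      obtain ⟨i, hi, hiq⟩ := genSystem_complete hn qs q hq
      have h := hδ (i + E.trim.cost) (mem_juxt_tests_right hi)
      rw [juxt_testPoly_right, hiq] at h
      -- `Σ_p eval x (∂f_q/∂c_p) · δ_p = δ_q` via `pderiv_inr_generator'` (Prelims, E-a).
      simpa [pderiv_inr_generator', apply_ite (MvPolynomial.eval x), map_one, map_zero, ite_mul, one_mul,
        zero_mul, Finset.sum_ite_eq', Finset.mem_univ, if_true]
        using h
    exact hsep δ hK hq
  · -- cost (`juxt_cost` RowCriterion l.164, `trim_cost`, `genSystem_cost`, S1)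
    rw [juxt_cost, trim_cost, genSystem_cost, corank_eq_finrank_ker]
    exact Nat.add_le_add_left (Nat.mul_le_mul_left _ hlen) _
  · -- the test ideal only grows
    refine Ideal.span_le.mpr ?_
    rintro _ ⟨j, hj, rfl⟩
    by_cases hjc : j < E.cost
    · exact Ideal.subset_span ⟨j, mem_juxt_tests_left (mem_trim_tests.mpr ⟨hj, hjc⟩),
        (juxt_testPoly_left _ _ (by simpa using hjc)).symm⟩
    · rw [testPoly_eq_zero_of_le (not_lt.mp hjc)]
      exact Ideal.zero_mem _
end EqSystem

end Summit.MatrixMultiplication.MatrixMultiplication.Theorems.GraphEquations
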